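import Summits.PneNP.PneNP.Theorems.ChebyshevTracialDesignTightMass
import Summits.PneNP.PneNP.Theorems.ChebyshevTracialDesignWeightedSNT
import Summits.PneNP.PneNP.Theorems.ChebyshevTracialDesignBernoulliMarginals
import HarnessLib

/-!
# Cell pnp-psdrank, route `ChebyshevTracialDesign`, brick 70b: the WEIGHTED mass form of spectral non-tightness —
# `Σ_{(U,M) tight} x_U z_M ≥ (29/960)·μ(x)·ν(z)·|Q_1(t)|` for a dense cut weight and a homogeneous-dense matching weight

Brick 69 (`…TightMass`) gives the MASS form of SNT for SETS: `#{(U,M) ∈ A × B tight} ≥ (29/60)·μ(A)ν(B)·|Q_1|` for a dense family `A` of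
`t`-cuts and a homogeneous-dense set `B` of matchings (mod Keevash–Lifshitz). The dense non-crossing psd cell works with WEIGHTS
(`x_U = tr X_U/r`, `z_M = tr Y_M/r`). Transfer: ROUND the matching weight (include each matching independently with probability `z_M`;
brick 70a: the good roundings — `(PM,4τ)`-homogeneous and dense — carry mass `≥ 1/4`, and the expected tight count against the rounding is
EXACTLY the weighted count by the marginal identity); on a good rounding `B`, brick 69 bounds `#tight(A × B) ≥ κ·|A|` for EVERY dense cut
set `A` with a constant `κ` LINEAR in nothing but `|A|`, so the cuts with fewer than `κ` tight partners in `B` form a SPARSE set and the cut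
weight integrates without rounding: `Σ_U x_U·#tight(U,B) ≥ κ·(Σx − sparse) ≥ κ·Σx/2`.
THEOREM `tight_mass_ge_of_globalLevelD` — for every `τ ≥ 2`: ∃ c₀ n₁, for even n ≥ n₁, odd t with n ≤ 5t, n ≤ 5(n−t), ε, ν ≥ exp(−c₀ dq n),
`x : OddSet n → [0,1]` vanishing off the t-cuts with `Σ x ≥ ε·#t-cuts`, `z : PM → [0,1]` with `(PM,τ)`-homogeneous extension and
`Σ z ≥ ν·#PM`:  `Σ_U Σ_M x_U z_M·[cc U M = 1] ≥ (29/960)·(Σx/#t-cuts)·(Σz/#PM)·|Q_1(t)|`.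
[cite: KeevashLifshitz2023, Thm. 1.8] [cite: KupavskiiZakharov2022, §2] [cite: Rothvoss2017, §2 (PDF p. 6)] [cite: AlonSpencer2016, Appendix A.1]
Stature: support/instrument (kernel theorems, no defs; conditional on `GlobalLevelDInequality`).
WHAT THIS IS NOT: nothing on psd rank of `P_PM(K_n)`, no P-vs-NP content. Supports stmt-PneNP-19878.
-/

set_option linter.dupNamespace false -- `Summit.PneNP.PneNP.…`: summit = sub-problem (D-0017)

noncomputable section

namespace Summit.PneNP.PneNP.Theorems.ChebyshevTracialDesignTightMassWeighted

open Finset Literature.Barriers.PneNP Literature.Combinatorics.Optimization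
open Literature.Combinatorics.SetFamily
open Literature.Combinatorics.AssociationSchemes.HomogeneousMatchingFamilies (image_val_subset)
open Literature.Combinatorics.Additive.KeevashLifshitz (GlobalLevelDInequality)
open Summit.PneNP.PneNP.Theorems.ChebyshevTracialDesignWeightedSNT
  (two_mul_exp_le_exp_half two_pow_le_pow_mul_card_supersets quad_le_two_pow_sub two_mul_card_sym2_add half_pow_le_exp_neg_half
    eight_mul_dq_le)
open Summit.PneNP.PneNP.Theorems.ChebyshevTracialDesignRungCells (card_tcuts_eq_choose)
open Summit.PneNP.PneNP.Theorems.ChebyshevTracialDesignDipoleHitRatio (card_pmatch_eq_pmCount)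
open Summit.PneNP.PneNP.Theorems.ChebyshevTracialDesignDimTwoDenseCellHomogeneous (wmass_ext_eq_sum)
open Summit.PneNP.PneNP.Theorems.ChebyshevTracialDesignTightMass (tight_card_ge_sym_oddSet_of_globalLevelD)
open Summit.PneNP.PneNP.Theorems.ChebyshevTracialDesignBernoulliMarginals

variable {n : ℕ}

/-! ### §3 The weighted mass form -/

set_option maxHeartbeats 400000 in -- elaborates at the default 200000 (measured); 2× head-room for farm rebuilds
/-- **WEIGHTED SNT, MASS FORM (mod Keevash–Lifshitz Thm 1.8).** Assume `GlobalLevelDInequality` and fix `τ ≥ 2`. There are `c₀ > 0`, `n₁`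
such that for even `n ≥ n₁`, odd `t` with `n ≤ 5t`, `n ≤ 5(n−t)`, thresholds `ε, ν ≥ exp(−c₀·dq n)`, every `x : OddSet n → [0,1]` vanishing
off the `t`-cuts with `Σ x ≥ ε·#t-cuts` and every `z : PM_n → [0,1]` whose edge-set extension is `(PM_n, τ)`-homogeneous with `Σ z ≥ ν·#PM_n`:
`Σ_U Σ_M x_U z_M [cc U M = 1] ≥ (29/960)·(Σx/#t-cuts)·(Σz/#PM_n)·|Q_1(t)|` — the tight mass of the weighted rectangle is at least a constant
fraction of its share. (Round the matching weight, brick 69 on the good event of probability `≥ 1/4`, exact marginals; on the cut side no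
rounding is needed: the set bound is linear in `|A|`, so the cuts with few tight partners form a sparse set.)
[cite: KeevashLifshitz2023, Thm. 1.8] [cite: KupavskiiZakharov2022, §2] [cite: Rothvoss2017, §2 (PDF p. 6)] [cite: AlonSpencer2016, Appendix A.1] -/
theorem tight_mass_ge_of_globalLevelD (hKL : GlobalLevelDInequality) {τ : ℝ} (hτ : 2 ≤ τ) :
    ∃ c₀ : ℝ, 0 < c₀ ∧ ∃ n₁ : ℕ, ∀ (n t : ℕ), n₁ ≤ n → Even n → Odd t → n ≤ 5 * t → n ≤ 5 * (n - t) →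
      ∀ (ε ν : ℝ), Real.exp (-(c₀ * dq n)) ≤ ε → Real.exp (-(c₀ * dq n)) ≤ ν →
      ∀ (x : OddSet n → ℝ) (z : PMatch n → ℝ), (∀ U, 0 ≤ x U ∧ x U ≤ 1) → (∀ U, U.1.card ≠ t → x U = 0) →
      ε * ((univ.filter fun U : OddSet n => U.1.card = t).card : ℝ) ≤ ∑ U, x U → (∀ M, 0 ≤ z M ∧ z M ≤ 1) →
      IsRelHomogeneousW τ (perfectMatchings (univ : Finset (Fin n)))
        (fun M : Finset (Sym2 (Fin n)) => if hM : IsPMOn (univ : Finset (Fin n)) M then z ⟨M, hM⟩ else 0)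
        ((univ : Finset (PMatch n)).image Subtype.val) →
      ν * (Fintype.card (PMatch n) : ℝ) ≤ ∑ M, z M →
      (29 / 960 : ℝ) * ((∑ U, x U) / ((univ.filter fun U : OddSet n => U.1.card = t).card : ℝ)) *
          ((∑ M, z M) / (Fintype.card (PMatch n) : ℝ)) * ((Qset n t 1).card : ℝ) ≤
        ∑ U, ∑ M, x U * z M * (if cc U M = 1 then (1 : ℝ) else 0) := by
  classical
  have hτ4 : (1 : ℝ) ≤ 4 * τ := by linarith
  obtain ⟨c₁, hc₁, N₁, hS⟩ := tight_card_ge_sym_oddSet_of_globalLevelD hKL hτ4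
  obtain ⟨N₂, hN₂⟩ := two_mul_exp_le_exp_half hc₁
  set c₀ : ℝ := min (c₁ / 2) (1 / 2) with hc₀_def
  have hc₀ : 0 < c₀ := lt_min (by positivity) (by norm_num)
  have hc₀c₁ : c₀ ≤ c₁ / 2 := min_le_left _ _
  have hc₀h : c₀ ≤ 1 / 2 := min_le_right _ _
  refine ⟨c₀, hc₀, max N₁ (max N₂ 40), ?_⟩
  intro n t hn hev hto h5 h5' ε ν hε hν x z hx hxt hxm hz hzh hzm
  have hN₁ : N₁ ≤ n := le_trans (le_max_left _ _) hn
  have hN₂n : N₂ ≤ n := le_trans ((le_max_left _ _).trans (le_max_right _ _)) hn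
  have h40 : 40 ≤ n := le_trans ((le_max_right _ _).trans (le_max_right _ _)) hn
  have hdq0 : (0 : ℝ) ≤ dq n := Nat.cast_nonneg _
  -- thresholds
  have hmono₂ : Real.exp (-(c₁ / 2 * dq n)) ≤ Real.exp (-(c₀ * dq n)) := Real.exp_le_exp.2 (by nlinarith)
  have hmono₃ : Real.exp (-((1 / 2 : ℝ) * dq n)) ≤ Real.exp (-(c₀ * dq n)) := Real.exp_le_exp.2 (by nlinarith)
  have hhalf2 := hN₂ n hN₂n
  have hε2 : Real.exp (-(c₁ * dq n)) ≤ ε / 2 := by linarith [hmono₂.trans hε]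
  have hν2 : Real.exp (-(c₁ * dq n)) ≤ ν / 2 := by linarith [hmono₂.trans hν]
  have hνhalf : (1 / 2 : ℝ) ^ dq n ≤ ν := ((half_pow_le_exp_neg_half (dq n)).trans hmono₃).trans hν
  have hεhalf : (1 / 2 : ℝ) ^ dq n ≤ ε := ((half_pow_le_exp_neg_half (dq n)).trans hmono₃).trans hε
  have hν0 : 0 < ν := lt_of_lt_of_le (by positivity) hνhalf
  have hε0 : 0 < ε := lt_of_lt_of_le (by positivity) hεhalf
  -- basic cardinalities
  have htn : t < n := by omega
  set T : Finset (OddSet n) := univ.filter fun U : OddSet n => U.1.card = t with hT_def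
  have hTcard : (T.card : ℝ) = (n.choose t : ℝ) := by rw [hT_def, card_tcuts_eq_choose hto]
  have hTpos : (0 : ℝ) < T.card := by rw [hTcard]; exact_mod_cast Nat.choose_pos htn.le
  set 𝒜 : Finset (Finset (Sym2 (Fin n))) := perfectMatchings (univ : Finset (Fin n)) with h𝒜_def
  set ℱ : Finset (Finset (Sym2 (Fin n))) := (univ : Finset (PMatch n)).image Subtype.val with hℱ_def
  set zx : Finset (Sym2 (Fin n)) → ℝ :=
    fun M => if hM : IsPMOn (univ : Finset (Fin n)) M then z ⟨M, hM⟩ else 0 with hzx_def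
  have hℱ𝒜 : ℱ ⊆ 𝒜 := image_val_subset _
  have hzx : ∀ A, 0 ≤ zx A ∧ zx A ≤ 1 := fun A => by
    by_cases hA : IsPMOn (univ : Finset (Fin n)) A
    · simp only [hzx_def, hA, dif_pos]; exact hz _
    · simp only [hzx_def, hA, dif_neg, not_false_eq_true, le_refl, zero_le_one, and_self]
  have hmass : wmass zx ℱ = ∑ M, z M := wmass_ext_eq_sum z
  have hcardA : (#𝒜 : ℝ) = Fintype.card (PMatch n) := by rw [card_pmatch_eq_pmCount, pmCount]
  have hApos : (0 : ℝ) < #𝒜 := by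
    rw [hcardA]
    exact_mod_cast Fintype.card_pos_iff.2 ⟨Classical.choice (by
      rw [← Fintype.card_pos_iff, card_pmatch_eq_pmCount]; exact pmCount_pos hev)⟩
  -- the star condition of the rounding lemma (as in brick 65)
  have hΛ : ∀ S : Finset (Sym2 (Fin n)), (supersets 𝒜 S).Nonempty →
      (2 * Fintype.card (Sym2 (Fin n)) + 10 : ℝ) * #𝒜 ≤ τ ^ #S * #(supersets 𝒜 S) * wmass zx ℱ := by
    intro S hSne
    have hstar := two_pow_le_pow_mul_card_supersets hev hτ hSne
    have hq : ((n * (n + 1) + 10 : ℕ) : ℝ) ≤ ((2 ^ (n / 2 - 1 - dq n) : ℕ) : ℝ) := by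
      exact_mod_cast quad_le_two_pow_sub hev (by omega)
    have hK : (2 * Fintype.card (Sym2 (Fin n)) + 10 : ℝ) = ((n * (n + 1) + 10 : ℕ) : ℝ) := by
      rw [← two_mul_card_sym2_add]; push_cast; ring
    have hdqle : dq n ≤ n / 2 - 1 := by have := eight_mul_dq_le (le_trans (by norm_num) h40); omega
    have hsplit : (2 : ℝ) ^ (n / 2 - 1) = 2 ^ (n / 2 - 1 - dq n) * 2 ^ dq n := by
      rw [← pow_add, Nat.sub_add_cancel hdqle]
    have hpow2 : ((2 ^ (n / 2 - 1 - dq n) : ℕ) : ℝ) * 1 ≤ (2 : ℝ) ^ (n / 2 - 1) * ν := by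
      rw [hsplit, mul_assoc]
      push_cast
      refine mul_le_mul_of_nonneg_left ?_ (pow_nonneg (by norm_num) _)
      calc (1 : ℝ) = 2 ^ dq n * (1 / 2) ^ dq n := by rw [← mul_pow]; norm_num
        _ ≤ 2 ^ dq n * ν := mul_le_mul_of_nonneg_left hνhalf (pow_nonneg (by norm_num) _)
    have hm : ν * #𝒜 ≤ wmass zx ℱ := by rw [hmass, hcardA]; exact hzm
    calc (2 * Fintype.card (Sym2 (Fin n)) + 10 : ℝ) * #𝒜
        ≤ ((2 ^ (n / 2 - 1 - dq n) : ℕ) : ℝ) * 1 * #𝒜 := by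
          rw [hK, mul_one]; exact mul_le_mul_of_nonneg_right hq hApos.le
      _ ≤ (2 : ℝ) ^ (n / 2 - 1) * ν * #𝒜 := mul_le_mul_of_nonneg_right hpow2 hApos.le
      _ ≤ τ ^ #S * #(supersets 𝒜 S) * ν * #𝒜 :=
          mul_le_mul_of_nonneg_right (mul_le_mul_of_nonneg_right hstar hν0.le) hApos.le
      _ = τ ^ #S * #(supersets 𝒜 S) * (ν * #𝒜) := by ring
      _ ≤ τ ^ #S * #(supersets 𝒜 S) * wmass zx ℱ :=
          mul_le_mul_of_nonneg_left hm (mul_nonneg (pow_nonneg (by linarith) _) (Nat.cast_nonneg _))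
  -- the good matching roundings
  have hgoodB := sum_bernoulli_good_ge_quarter (by linarith : (0 : ℝ) ≤ τ) hℱ𝒜 hzx hzh hΛ
  -- notation
  set C : ℝ := (T.card : ℝ) with hC_def
  set PMr : ℝ := (Fintype.card (PMatch n) : ℝ) with hPMr_def
  set Qr : ℝ := ((Qset n t 1).card : ℝ) with hQr_def
  set sx : ℝ := ∑ U, x U with hsx_def
  set sz : ℝ := ∑ M, z M with hsz_def
  have hPMpos : 0 < PMr := by rw [← hcardA]; exact hApos
  have hQr0 : 0 ≤ Qr := Nat.cast_nonneg _
  have hsx0 : 0 ≤ sx := sum_nonneg fun U _ => (hx U).1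
  have hsz0 : 0 ≤ sz := sum_nonneg fun M _ => (hz M).1
  have hsxT : sx = ∑ U ∈ T, x U := by
    rw [hsx_def, ← sum_filter_add_sum_filter_not univ (fun U : OddSet n => U.1.card = t)]
    have h0 : ∑ U ∈ univ.filter (fun U : OddSet n => ¬U.1.card = t), x U = 0 :=
      sum_eq_zero fun U hU => hxt U (mem_filter.1 hU).2
    rw [h0, add_zero]
  have hεC : ε * C ≤ sx := hxm
  -- the bound on the good event
  set L : ℝ := (29 / 60 : ℝ) * (sx / (2 * C)) * (sz / (2 * PMr)) * Qr with hL_def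
  have hL0 : 0 ≤ L := by
    rw [hL_def]
    refine mul_nonneg (mul_nonneg (mul_nonneg (by norm_num) (div_nonneg hsx0 (mul_pos two_pos hTpos).le))
      (div_nonneg hsz0 (mul_pos two_pos hPMpos).le)) hQr0
  -- `f̃(A) = Σ_U x_U·[cc U A = 1]` on perfect matchings, `0` elsewhere
  set ft : Finset (Sym2 (Fin n)) → ℝ := fun A =>
    if hA : IsPMOn (univ : Finset (Fin n)) A then ∑ U, x U * (if cc U ⟨A, hA⟩ = 1 then (1 : ℝ) else 0) else 0 with hft_def
  have hft0 : ∀ A, 0 ≤ ft A := fun A => by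
    rw [hft_def]; dsimp only
    split_ifs
    · exact sum_nonneg fun U _ => mul_nonneg (hx U).1 (by split_ifs <;> norm_num)
    · exact le_rfl
  -- STEP B: on a good rounding `ℬ`, `Σ_{A ∈ ℬ} f̃(A) ≥ L`
  have hB : ∀ ℬ ∈ ℱ.powerset, IsRelHomogeneous (4 * τ) 𝒜 ℬ ∧ wmass zx ℱ ≤ 2 * #ℬ → L ≤ ∑ A ∈ ℬ, ft A := by
    intro ℬ hℬ hgood
    have hℬℱ : ℬ ⊆ ℱ := mem_powerset.1 hℬ
    set Y : Finset (PMatch n) := univ.filter fun M : PMatch n => M.1 ∈ ℬ with hY_def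
    have hYimg : Y.image Subtype.val = ℬ := by
      ext A
      simp only [mem_image, mem_filter, mem_univ, true_and, hY_def]
      constructor
      · rintro ⟨M, hM, rfl⟩; exact hM
      · intro hA
        obtain ⟨M, -, rfl⟩ := mem_image.1 (hℬℱ hA)
        exact ⟨M, hA, rfl⟩
    have hYcard : (Y.card : ℝ) = #ℬ := by rw [← hYimg, card_image_of_injective _ Subtype.val_injective]
    have hYν : sz ≤ 2 * (Y.card : ℝ) := by rw [hYcard, ← hmass]; exact hgood.2
    have hdY : Real.exp (-(c₁ * dq n)) ≤ (Y.card : ℝ) / (Fintype.card (PMatch n) : ℝ) := by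
      rw [le_div_iff₀ hPMpos]
      calc Real.exp (-(c₁ * dq n)) * PMr ≤ ν / 2 * PMr := mul_le_mul_of_nonneg_right hν2 hPMpos.le
        _ ≤ Y.card := by linarith [hzm, hYν]
    -- `Σ_{A∈ℬ} f̃ = Σ_{U∈T} x_U g(U)`, `g(U) = #{M ∈ Y : cc U M = 1}`
    set g : OddSet n → ℝ := fun U => ∑ M ∈ Y, (if cc U M = 1 then (1 : ℝ) else 0) with hg_def
    have hg0 : ∀ U, 0 ≤ g U := fun U => sum_nonneg fun M _ => by split_ifs <;> norm_num
    have hsumB : ∑ A ∈ ℬ, ft A = ∑ U ∈ T, x U * g U := by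
      have e1 : ∑ A ∈ ℬ, ft A = ∑ M ∈ Y, ∑ U, x U * (if cc U M = 1 then (1 : ℝ) else 0) := by
        rw [← hYimg, sum_image fun M _ M' _ h => Subtype.ext h]
        refine sum_congr rfl fun M _ => ?_
        rw [hft_def]; dsimp only
        rw [dif_pos M.2]
      rw [e1, sum_comm]
      have e2 : ∀ U, ∑ M ∈ Y, x U * (if cc U M = 1 then (1 : ℝ) else 0) = x U * g U := fun U => by
        rw [hg_def]; dsimp only; rw [mul_sum]
      simp_rw [e2]
      rw [← sum_filter_add_sum_filter_not univ (fun U : OddSet n => U.1.card = t)]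
      have h0 : ∑ U ∈ univ.filter (fun U : OddSet n => ¬U.1.card = t), x U * g U = 0 :=
        sum_eq_zero fun U hU => by rw [hxt U (mem_filter.1 hU).2, zero_mul]
      rw [h0, add_zero]
    -- the set bound for `A × Y`, linear in `|A|`
    obtain ⟨κ, hκ_def⟩ : ∃ κ : ℝ, κ = (29 / 60 : ℝ) * ((Y.card : ℝ) / PMr) * Qr / C := ⟨_, rfl⟩
    have hκ0 : 0 ≤ κ := by
      rw [hκ_def]
      exact div_nonneg (mul_nonneg (mul_nonneg (by norm_num) (div_nonneg (Nat.cast_nonneg _) hPMpos.le)) hQr0) hTpos.le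
    have hset : ∀ A : Finset (OddSet n), A ⊆ T → Real.exp (-(c₁ * dq n)) ≤ (A.card : ℝ) / (n.choose t : ℝ) →
        κ * A.card ≤ ∑ U ∈ A, g U := by
      intro A hAT hAd
      have hAt : ∀ U ∈ A, U.1.card = t := fun U hU => (mem_filter.1 (hAT hU)).2
      have h := hS n t hN₁ hev hto h5 h5' A hAt Y (by rw [hYimg]; exact hgood.1) hAd hdY
      have hcount : ((((A ×ˢ Y).filter fun UM : OddSet n × PMatch n => cc UM.1 UM.2 = 1).card : ℕ) : ℝ) = ∑ U ∈ A, g U := by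
        rw [card_filter, Nat.cast_sum, sum_product]
        refine sum_congr rfl fun U _ => ?_
        rw [hg_def]
        exact sum_congr rfl fun M _ => by split_ifs <;> simp
      rw [hcount, ← hTcard] at h
      calc κ * A.card = 29 / 60 * ((A.card : ℝ) / C) * ((Y.card : ℝ) / PMr) * Qr := by
            rw [hκ_def]; ring
        _ ≤ ∑ U ∈ A, g U := h
    -- the bad cuts are sparse
    obtain ⟨Abad, hAbad_def⟩ : ∃ A : Finset (OddSet n), A = T.filter fun U => g U < κ := ⟨_, rfl⟩
    have hAbadT : Abad ⊆ T := by rw [hAbad_def]; exact filter_subset _ _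
    have hAbad_small : (Abad.card : ℝ) < Real.exp (-(c₁ * dq n)) * C := by
      by_contra hcon
      rw [not_lt] at hcon
      have hCpos : (0 : ℝ) < (n.choose t : ℝ) := by rw [← hTcard]; exact hTpos
      have hAd : Real.exp (-(c₁ * dq n)) ≤ (Abad.card : ℝ) / (n.choose t : ℝ) := by
        rw [le_div_iff₀ hCpos, ← hTcard]; exact hcon
      have hne : Abad.Nonempty := by
        rw [← card_pos]
        have : (0 : ℝ) < Abad.card := lt_of_lt_of_le (mul_pos (Real.exp_pos _) hTpos) hcon
        exact_mod_cast this
      have h1 := hset Abad hAbadT hAd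
      have h2 : ∑ U ∈ Abad, g U < ∑ _U ∈ Abad, κ :=
        sum_lt_sum_of_nonempty hne fun U hU => by rw [hAbad_def] at hU; exact (mem_filter.1 hU).2
      rw [sum_const, nsmul_eq_mul, mul_comm] at h2
      linarith
    have hAbad_half : (Abad.card : ℝ) ≤ sx / 2 := by
      have : Real.exp (-(c₁ * dq n)) * C ≤ ε / 2 * C := mul_le_mul_of_nonneg_right hε2 hTpos.le
      linarith
    -- `Σ_{U∈T} x_U g(U) ≥ κ·(sx − |Abad|) ≥ κ·sx/2`
    have hmain : κ * (sx / 2) ≤ ∑ U ∈ T, x U * g U := by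
      have hsplit := sum_filter_add_sum_filter_not T (fun U => g U < κ) (fun U => x U * g U)
      have hgoodpart : κ * ∑ U ∈ T.filter (fun U => ¬g U < κ), x U ≤ ∑ U ∈ T.filter (fun U => ¬g U < κ), x U * g U := by
        rw [mul_sum]
        refine sum_le_sum fun U hU => ?_
        have hge : κ ≤ g U := not_lt.1 (mem_filter.1 hU).2
        calc κ * x U = x U * κ := mul_comm _ _
          _ ≤ x U * g U := mul_le_mul_of_nonneg_left hge (hx U).1
      have hbadpart : 0 ≤ ∑ U ∈ T.filter (fun U => g U < κ), x U * g U :=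
        sum_nonneg fun U _ => mul_nonneg (hx U).1 (hg0 U)
      have hxsplit := sum_filter_add_sum_filter_not T (fun U => g U < κ) x
      have hxbad : ∑ U ∈ T.filter (fun U => g U < κ), x U ≤ Abad.card := by
        rw [hAbad_def]
        calc ∑ U ∈ T.filter (fun U => g U < κ), x U ≤ ∑ _U ∈ T.filter (fun U => g U < κ), (1 : ℝ) :=
              sum_le_sum fun U _ => (hx U).2
          _ = _ := by rw [sum_const, nsmul_eq_mul, mul_one]
      have hxgood : sx / 2 ≤ ∑ U ∈ T.filter (fun U => ¬g U < κ), x U := by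
        rw [hsxT] at hAbad_half ⊢; linarith
      calc κ * (sx / 2) ≤ κ * ∑ U ∈ T.filter (fun U => ¬g U < κ), x U := mul_le_mul_of_nonneg_left hxgood hκ0
        _ ≤ ∑ U ∈ T.filter (fun U => ¬g U < κ), x U * g U := hgoodpart
        _ ≤ ∑ U ∈ T, x U * g U := by rw [← hsplit]; linarith
    -- `L ≤ κ·sx/2`
    rw [hsumB]
    refine le_trans ?_ hmain
    rw [hL_def, hκ_def]
    have h1 : sz / (2 * PMr) ≤ (Y.card : ℝ) / PMr := by
      rw [div_le_div_iff₀ (mul_pos two_pos hPMpos) hPMpos]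
      calc sz * PMr ≤ 2 * (Y.card : ℝ) * PMr := mul_le_mul_of_nonneg_right hYν hPMpos.le
        _ = (Y.card : ℝ) * (2 * PMr) := by ring
    have h29 : (0 : ℝ) ≤ 29 / 60 * (sx / (2 * C)) :=
      mul_nonneg (by norm_num) (div_nonneg hsx0 (mul_pos two_pos hTpos).le)
    calc 29 / 60 * (sx / (2 * C)) * (sz / (2 * PMr)) * Qr
        ≤ 29 / 60 * (sx / (2 * C)) * ((Y.card : ℝ) / PMr) * Qr :=
          mul_le_mul_of_nonneg_right (mul_le_mul_of_nonneg_left h1 h29) hQr0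
      _ = 29 / 60 * ((Y.card : ℝ) / PMr) * Qr / C * (sx / 2) := by ring
  -- STEP A: the matching-side marginal and the good event
  have hLHS : ∑ U, ∑ M, x U * z M * (if cc U M = 1 then (1 : ℝ) else 0) = ∑ A ∈ ℱ, zx A * ft A := by
    rw [hℱ_def, sum_image fun M _ M' _ h => Subtype.ext h, sum_comm]
    refine sum_congr rfl fun M _ => ?_
    have hz' : zx M.1 = z M := by rw [hzx_def]; dsimp only; rw [dif_pos M.2]
    have hf' : ft M.1 = ∑ U, x U * (if cc U M = 1 then (1 : ℝ) else 0) := by rw [hft_def]; dsimp only; rw [dif_pos M.2]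
    rw [hz', hf', mul_sum]
    exact sum_congr rfl fun U _ => by ring
  rw [hLHS, ← bern_sum_sum_eq ℱ zx ft]
  have hP0 : ∀ ℬ : Finset (Finset (Sym2 (Fin n))), 0 ≤ (∏ A ∈ ℬ, zx A) * ∏ A ∈ ℱ \ ℬ, (1 - zx A) :=
    fun ℬ => bern_nonneg hzx
  calc 29 / 960 * (sx / C) * (sz / PMr) * Qr = L * (1 / 4) := by rw [hL_def]; ring
    _ ≤ L * ∑ ℬ ∈ ℱ.powerset, ((∏ A ∈ ℬ, zx A) * ∏ A ∈ ℱ \ ℬ, (1 - zx A)) *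
          (if IsRelHomogeneous (4 * τ) 𝒜 ℬ ∧ wmass zx ℱ ≤ 2 * #ℬ then (1 : ℝ) else 0) :=
        mul_le_mul_of_nonneg_left hgoodB hL0
    _ = ∑ ℬ ∈ ℱ.powerset, ((∏ A ∈ ℬ, zx A) * ∏ A ∈ ℱ \ ℬ, (1 - zx A)) *
          ((if IsRelHomogeneous (4 * τ) 𝒜 ℬ ∧ wmass zx ℱ ≤ 2 * #ℬ then (1 : ℝ) else 0) * L) := by
        rw [mul_sum]; exact sum_congr rfl fun ℬ _ => by ring
    _ ≤ ∑ ℬ ∈ ℱ.powerset, ((∏ A ∈ ℬ, zx A) * ∏ A ∈ ℱ \ ℬ, (1 - zx A)) * ∑ A ∈ ℬ, ft A := by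
        refine sum_le_sum fun ℬ hℬ => mul_le_mul_of_nonneg_left ?_ (hP0 ℬ)
        split_ifs with hg
        · rw [one_mul]; exact hB ℬ hℬ hg
        · rw [zero_mul]; exact sum_nonneg fun A _ => hft0 A

end Summit.PneNP.PneNP.Theorems.ChebyshevTracialDesignTightMassWeighted
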